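import Literature.MathematicalPhysics.QuantumFieldTheory.Balaban1983to89.B2Ineq329PrismHolonomy
import Literature.MathematicalPhysics.QuantumFieldTheory.Balaban1983to89.B4PartitionUnity22

/-!
# `Balaban1983to89.B1TorusCubeCover` — [Balaban1983RegularityDecay] §2 p. 575 ON THE TORUS `T_ε` OF [Balaban1982Higgs1] (1.2):
# the cubes «□_j … a cube of the size 2M and with center in Mj» as windows of `2K₀` blocks of the (Higgs)₂,₃ torus
# `HiggsLattice.Site P 0`, the PERIODIC partition of unity «{h_j}, Σ_j h_j² = 1» and cut-off «θ_j» built from r01's profiles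
# `hprof`/`thetaProf` (`B4PartitionUnity22`), their supports, their pull-backs along the cube charts, and the row
# multiplicity `2^d` of the cube cores — the geometry consumed by this seat's torus version of THEOREM (1.10)

statement-level skeleton of published theorems with citation tags; proofs where landed; nothing here is a claim about the Yang–Mills mass gap

CITATION HEADER (lean-in-tree rule).  T. Bałaban, *Regularity and decay of lattice Green's functions*, Commun. Math. Phys.
**89** (1983) 571–597 [Balaban1983RegularityDecay] (cell paper B4; held text `paper:balaban1983-cmp89-regularity-decay`,
journal page = PDF page + 570; p. 575 read by this seat) and T. Bałaban, *(Higgs)₂,₃ quantum fields in a finite volume. I*,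
Commun. Math. Phys. **85** (1982) 603–626 [Balaban1982Higgs1] ((1.2) p. 604 the torus, (1.17)–(1.20) p. 607 the blocks).
Cell `lit-balaban` (HOME `run/shared/lean/pub/lit-balaban/`), Phase-2 proof seat **p35** gen 8 (unit `lit-balaban-p35`); SKELETON
rows **B4.Def§2** (cubes □_j, h_j, θ_j — here on the torus of record of B1), **B4.Thm@573**/(1.10) and **B1.Prop2.1**/(2.25) on
`Ω = T_ε` (the consumer: the scalar half `hGs` of the B1.Thm@606 model ledger, `B1Ineq367SmallFieldTorus`).  USED BY NAME,
never restated: the typer's `HiggsLattice.{Params, Site, Site.shift}`, `HiggsAveraging.blockIter`, p15's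
`B2Ineq329ZeroAveraging.{val_blockIter, shiftN_apply_self, shiftN_apply_ne}`, r01's `B4PartitionUnity22.{hprof, thetaProf, …}`
(`Σ_{n∈ℤ} h(t−n)² = 1`: `sum_hprof_sq`).  RELATION TO THE TREE: r01's `hCube`/`hZ` (ℤ^{d+1} positions) and p38's
`B5TorusPartition` (a different, normalised trapezoid profile on `Setup` tori) are the two existing partitions; this file is the
`hprof`-PERIODISATION on the (Higgs)₂,₃ torus, whose pull-back along a cube chart IS r01's profile (so that the lineage's box
theorems `B4Eq220PartitionSizes.hsize_hBox`, `B4Eq220CubeField.…` apply on each cube).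

WHAT IS PRINTED (p. 575, verbatim up to OCR).  *«For each j ∈ Z^d, let us define the set □_j = Ω ∩ {a sum of large blocks for
which the point Mj is one of the vertices}. Let us observe that if the point Mj is not a boundary point of Ω, then □_j is a
cube of the size 2M and with center in Mj. … Next let us define a partition of unity {h_j}_{j∈Z^d} on T_η. For each j ∈ Z^d,
we take h_j(x) = Π_{μ=1}^d h_{j_μ}(x_μ), … h_j(x) = h(x/M − j), h ∈ C₀^∞(]−⅔, ⅔[), h(x) = 1 for x ∈ [−⅓, ⅓], and it is chosen
in such a way that Σ_{j∈Z} h_j² = 1. … We take a function θ ∈ C₀^∞(]−1, 1[), θ = 1 on [−¾, ¾], and we define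
θ_j(x) = Π_μ θ(x_μ/M − j_μ), Ã_j = A₀ + θ_jA′.»*  On the TORUS `T_η` (no boundary) every `□_j` is an interior cube; the label
set is `Π_μ ℤ/N_μℤ` with `N_μ` cubes per direction.

WHAT THIS FILE PROVES (kernel-checked, zero `sorry`; definitions with bodies + theorems; no `def … : Prop` fact).
* §1 `half` (= the print's `M` in fine sites: `L^K·K₀`), `nLab` (cubes per direction), `Lab` (labels), `nLab_mul_half`,
  `two_le_nLab` (under `K ≤ K_P`, `K₀ ∣ M`, `K₀ ≥ 1`).
* §2 `ctr`, `chart` (the cube chart `y ↦ Mj − M + y`), `Near r j` (sites within `r` of the centre `Mj`, coordinatewise, on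
  the torus), `InCube j` (the `2M`-window), monotonicity/neighbour/block lemmas (`near_mono`, `near_shift`, `near_unshift`,
  `near_of_blockIter_eq`, `inCube_of_near`); chart lemmas `near_chart`, `inCube_iff_exists_chart` (`□_j = chart_j [0,2M)^d`),
  `chart_injOn` (no wrap-around: `2M ≤ |T_ε|_μ`), `chart_arg`.
* §3 **`card_filter_near_le`** — ROW MULTIPLICITY: for `r < M` at most `2^d` labels `j` have a given site within `r` of `Mj`
  (pure torus arithmetic: three labels in one direction would need three integers pairwise at distance exactly `M`).
* §4 the periodisation `per3 g N t = g(t) + g(t−N) + g(t+N)` of a profile vanishing off `]−1,1[` (`per3_eval`), the torus bumps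
  **`hTor`** (`h_j`) and **`thetaTor`** (`θ_j`): `hTor_nonneg`, `hTor_le_one`, **`sum_hTor_sq`** (`Σ_j h_j(x)² = 1` EXACTLY on the
  torus), **`hTor_chart`**/**`thetaTor_chart`** (pull-backs along the chart = r01's profiles at `x/M − 1`), `near_of_hTor_ne_zero`
  (`supp h_j ⊆ {|x − Mj| ≤ ⅝M}`), **`thetaTor_eq_one_of_near`** (`θ_j = 1` on `{|x − Mj| ≤ ¾M}`).
HONEST SCOPE.  Geometry only; the cube half-side `M = L^KK₀` must divide the torus side (`K₀ ∣ P.M`, B1 p. 604 *«L, M will be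
described later»*; `8 ∣ K₀` makes `⅝M`, `¾M`, `⅞M` integers); no operator, no estimate of [B4] is proved here.  Unit
`lit-balaban-p35` gen 8 (literature-prover-lit-balaban-p35-g8-0).
-/

open scoped BigOperators

noncomputable section

namespace Literature.MathematicalPhysics.QuantumFieldTheory.Balaban1983to89.B1TorusCubeCover

open Literature.MathematicalPhysics.QuantumFieldTheory.Balaban1983to89.HiggsLattice
open Literature.MathematicalPhysics.QuantumFieldTheory.Balaban1983to89.HiggsAveraging
open Literature.MathematicalPhysics.QuantumFieldTheory.Balaban1983to89.B2Ineq329ZeroAveraging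
  (val_blockIter shiftN_apply_self shiftN_apply_ne)
open Literature.MathematicalPhysics.QuantumFieldTheory.Balaban1983to89.B4PartitionUnity22

variable {P : Params}

/-! ## §1 The cube size `M = L^K·K₀` (fine sites) and the number of cubes per direction -/

/-- The half-side of a cube «of the size 2M» in FINE sites at level `K`: `M = L^K·K₀` (`K₀` large blocks of `L^K` sites;
the print's `M` counted in unit blocks is `K₀`). [cite: Balaban1983RegularityDecay, §2 p.575] -/
def half (P : Params) (K K₀ : ℕ) : ℕ := P.L ^ K * K₀

/-- The number of cubes per direction on the torus: `N_μ = |T_ε|_μ / M`. [cite: Balaban1983RegularityDecay, §2 p.575] -/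
def nLab (P : Params) (K K₀ : ℕ) (μ : Fin P.d) : ℕ := P.sitesPerDir 0 μ / half P K K₀

/-- The cube labels `j` («for each j ∈ Z^d»; on the torus `j ∈ Π_μ ℤ/N_μℤ`). [cite: Balaban1983RegularityDecay, §2 p.575] -/
abbrev Lab (P : Params) (K K₀ : ℕ) : Type := (μ : Fin P.d) → Fin (nLab P K K₀ μ)

section Arith

variable {K K₀ : ℕ}

/-- `M > 0` for `K₀ ≥ 1`. [cite: Balaban1983RegularityDecay, §2 p.575] -/
theorem half_pos (hK₀ : 1 ≤ K₀) : 0 < half P K K₀ :=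
  Nat.mul_pos (pow_pos P.hL K) hK₀

/-- `M` divides the torus side when `K ≤ K_P` and `K₀ ∣ M_P` ((1.2): `|T_ε|_μ = 2L^{K_P}M_PL′_μ`).
[cite: Balaban1982Higgs1, (1.2) p.604] -/
theorem half_dvd (hK : K ≤ P.K) (hK₀ : K₀ ∣ P.M) (μ : Fin P.d) : half P K K₀ ∣ P.sitesPerDir 0 μ := by
  unfold half Params.sitesPerDir
  have h1 : P.L ^ K ∣ P.L ^ (P.K - 0) := pow_dvd_pow _ (by omega)
  exact Dvd.dvd.mul_left (Dvd.dvd.mul_right (mul_dvd_mul h1 hK₀) _) 2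

/-- `N_μ · M = |T_ε|_μ`. [cite: Balaban1982Higgs1, (1.2) p.604] -/
theorem nLab_mul_half (hK : K ≤ P.K) (hK₀ : K₀ ∣ P.M) (μ : Fin P.d) :
    nLab P K K₀ μ * half P K K₀ = P.sitesPerDir 0 μ :=
  Nat.div_mul_cancel (half_dvd hK hK₀ μ)

/-- There are at least two cubes per direction: `N_μ = 2L^{K_P−K}(M_P/K₀)L′_μ ≥ 2`. [cite: Balaban1982Higgs1, (1.2) p.604] -/
theorem two_le_nLab (hK : K ≤ P.K) (hK₀ : K₀ ∣ P.M) (hK₀' : 1 ≤ K₀) (μ : Fin P.d) : 2 ≤ nLab P K K₀ μ := by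
  obtain ⟨q, hq⟩ := hK₀
  have hq0 : 0 < q := by
    rcases Nat.eq_zero_or_pos q with h | h
    · exfalso; have := P.hM; rw [hq, h, mul_zero] at this; exact lt_irrefl _ this
    · exact h
  unfold nLab half Params.sitesPerDir
  have hLK : 0 < P.L ^ K := pow_pos P.hL K
  have e : 2 * (P.L ^ (P.K - 0) * P.M * P.Lp μ) = (P.L ^ K * K₀) * (2 * (P.L ^ (P.K - K) * q * P.Lp μ)) := by
    rw [hq, show P.K - 0 = K + (P.K - K) by omega, pow_add]; ring
  rw [e, Nat.mul_div_cancel_left _ (Nat.mul_pos hLK hK₀')]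
  have : 1 ≤ P.L ^ (P.K - K) * q * P.Lp μ := Nat.mul_pos (Nat.mul_pos (pow_pos P.hL _) hq0) (P.hLp μ)
  omega

end Arith

/-! ## §2 Centres, charts, the cores `{|x − Mj| ≤ r}` and the windows `□_j` -/

section Geometry

variable (K K₀ : ℕ)

/-- The centre `Mj` of the cube `□_j`, coordinate `μ`, as an integer label of `T_ε`. [cite: Balaban1983RegularityDecay, §2 p.575] -/
def ctr (j : Lab P K K₀) (μ : Fin P.d) : ℤ := (half P K K₀ : ℤ) * ((j μ : ℕ) : ℤ)

/-- The cube chart of `□_j`: box coordinates `y ∈ [0, 2M)^d` ↦ the torus site `Mj − M + y`.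
[cite: Balaban1983RegularityDecay, §2 p.575] -/
def chart (j : Lab P K K₀) (y : Fin P.d → ℤ) : Site P 0 :=
  fun μ => ((ctr K K₀ j μ - half P K K₀ + y μ : ℤ) : ZMod (P.sitesPerDir 0 μ))

/-- `Near r j x`: the torus site `x` lies within `r` of the centre `Mj` in every coordinate, i.e. `x_μ = Mj_μ + z_μ` with
`|z_μ| ≤ r` — the sets «{x : |x − Mj| ≤ ¾M}» etc. of p. 575. [cite: Balaban1983RegularityDecay, §2 p.575] -/
def Near (r : ℕ) (j : Lab P K K₀) (x : Site P 0) : Prop :=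
  ∀ μ, ∃ z ∈ Finset.Icc (-(r : ℤ)) r, x μ = ((ctr K K₀ j μ + z : ℤ) : ZMod (P.sitesPerDir 0 μ))

/-- `Near` is decidable (finite search). [folklore] -/
instance (r : ℕ) (j : Lab P K K₀) : DecidablePred (Near K K₀ r j) := by
  intro x; unfold Near; infer_instance

/-- `InCube j x`: `x` lies in the window `□_j = {Mj − M ≤ x_μ < Mj + M}` (a union of `2K₀` blocks per direction).
[cite: Balaban1983RegularityDecay, §2 p.575] -/
def InCube (j : Lab P K K₀) (x : Site P 0) : Prop :=
  ∀ μ, ∃ z ∈ Finset.Ico (-(half P K K₀ : ℤ)) (half P K K₀), x μ = ((ctr K K₀ j μ + z : ℤ) : ZMod (P.sitesPerDir 0 μ))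

/-- `InCube` is decidable. [folklore] -/
instance (j : Lab P K K₀) : DecidablePred (InCube K K₀ j) := by
  intro x; unfold InCube; infer_instance

/-- The cube `□_j ⊂ T_ε` as a finite set of sites. [cite: Balaban1983RegularityDecay, §2 p.575] -/
def cube (j : Lab P K K₀) : Finset (Site P 0) := Finset.univ.filter (InCube K K₀ j)

variable {K K₀}

/-- Unfolding of `cube`. [cite: Balaban1983RegularityDecay, §2 p.575] -/
theorem mem_cube {j : Lab P K K₀} {x : Site P 0} : x ∈ cube K K₀ j ↔ InCube K K₀ j x := by
  simp [cube]

/-- Cores grow with the radius. [cite: Balaban1983RegularityDecay, §2 p.575] -/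
theorem near_mono {r r' : ℕ} (h : r ≤ r') {j : Lab P K K₀} {x : Site P 0} (hx : Near K K₀ r j x) : Near K K₀ r' j x := by
  intro μ
  obtain ⟨z, hz, e⟩ := hx μ
  refine ⟨z, ?_, e⟩
  simp only [Finset.mem_Icc] at hz ⊢
  constructor <;> omega

/-- A core of radius `< M` lies in the cube window. [cite: Balaban1983RegularityDecay, §2 p.575] -/
theorem inCube_of_near {r : ℕ} (hr : r < half P K K₀) {j : Lab P K K₀} {x : Site P 0} (hx : Near K K₀ r j x) :
    InCube K K₀ j x := by
  intro μ
  obtain ⟨z, hz, e⟩ := hx μ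
  refine ⟨z, ?_, e⟩
  simp only [Finset.mem_Icc] at hz
  simp only [Finset.mem_Ico]
  constructor <;> omega

/-- The forward neighbour of a site within `r` of `Mj` is within `r + 1`. [cite: Balaban1983RegularityDecay, §2 p.575] -/
theorem near_shift {r : ℕ} {j : Lab P K K₀} {x : Site P 0} (hx : Near K K₀ r j x) (ν : Fin P.d) :
    Near K K₀ (r + 1) j (x.shift ν) := by
  intro μ
  obtain ⟨z, hz, e⟩ := hx μ
  simp only [Finset.mem_Icc] at hz
  by_cases hμ : μ = ν
  · subst hμ
    refine ⟨z + 1, by simp only [Finset.mem_Icc]; constructor <;> push_cast <;> omega, ?_⟩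
    show Function.update x μ (x μ + 1) μ = _
    rw [Function.update_self, e]
    push_cast; ring
  · refine ⟨z, by simp only [Finset.mem_Icc]; constructor <;> push_cast <;> omega, ?_⟩
    show Function.update x ν (x ν + 1) μ = _
    rw [Function.update_of_ne hμ, e]

/-- The backward neighbour of a site within `r` of `Mj` is within `r + 1`. [cite: Balaban1983RegularityDecay, §2 p.575] -/
theorem near_unshift {r : ℕ} {j : Lab P K K₀} {x : Site P 0} (hx : Near K K₀ r j x) (ν : Fin P.d) :
    Near K K₀ (r + 1) j (x.unshift ν) := by
  intro μ
  obtain ⟨z, hz, e⟩ := hx μ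
  simp only [Finset.mem_Icc] at hz
  by_cases hμ : μ = ν
  · subst hμ
    refine ⟨z - 1, by simp only [Finset.mem_Icc]; constructor <;> push_cast <;> omega, ?_⟩
    show Function.update x μ (x μ - 1) μ = _
    rw [Function.update_self, e]
    push_cast; ring
  · refine ⟨z, by simp only [Finset.mem_Icc]; constructor <;> push_cast <;> omega, ?_⟩
    show Function.update x ν (x ν - 1) μ = _
    rw [Function.update_of_ne hμ, e]

/-- If `x′.shift ν = x` then `x′ = x.unshift ν` (the translations `x ↦ x ± εe_ν` of the torus (1.2) are mutually inverse).
[cite: Balaban1982Higgs1, (1.2) p.604] -/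
theorem eq_unshift_of_shift_eq {x x' : Site P 0} {ν : Fin P.d} (h : x'.shift ν = x) : x' = x.unshift ν := by
  subst h
  funext μ
  by_cases hμ : μ = ν
  · subst hμ
    show x' μ = Function.update (Function.update x' μ (x' μ + 1)) μ (Function.update x' μ (x' μ + 1) μ - 1) μ
    rw [Function.update_self, Function.update_self]; ring
  · show x' μ = Function.update (x'.shift ν) ν _ μ
    rw [Function.update_of_ne hμ]
    show x' μ = Function.update x' ν (x' ν + 1) μ
    rw [Function.update_of_ne hμ]


/-- A site of the `K`-block of a site within `r` of `Mj` is within `r + (L^K − 1)` of `Mj` (the blocks (1.17)–(1.20) do not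
wrap around the torus: `(x_K)_μ = ⌊x_μ/L^K⌋`, p15's `val_blockIter`). [cite: Balaban1982Higgs1, (1.20) p.607] -/
theorem near_of_blockIter_eq (hK : K ≤ P.K) {r : ℕ} {j : Lab P K K₀} {x x' : Site P 0} (hx : Near K K₀ r j x)
    (h : blockIter K x' = blockIter K x) : Near K K₀ (r + (P.L ^ K - 1)) j x' := by
  intro μ
  obtain ⟨z, hz, e⟩ := hx μ
  simp only [Finset.mem_Icc] at hz
  set n : ℕ := P.L ^ K with hn_def
  have hq : (x' μ).val / n = (x μ).val / n := by
    rw [hn_def, ← val_blockIter hK x' μ, ← val_blockIter hK x μ, h]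
  have hn : 0 < n := by rw [hn_def]; exact pow_pos P.hL K
  have h1 : (x μ).val < (x μ).val / n * n + n := Nat.lt_div_mul_add hn
  have h2 : (x' μ).val < (x' μ).val / n * n + n := Nat.lt_div_mul_add hn
  have h3 : (x μ).val / n * n ≤ (x μ).val := Nat.div_mul_le_self _ _
  have h4 : (x' μ).val / n * n ≤ (x' μ).val := Nat.div_mul_le_self _ _
  rw [hq] at h2 h4
  set v : ℕ := (x μ).val with hv
  set v' : ℕ := (x' μ).val with hv'
  set q : ℕ := v / n * n with hq_def
  refine ⟨z + ((v' : ℤ) - (v : ℤ)), ?_, ?_⟩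
  · simp only [Finset.mem_Icc]
    have hn1 : 1 ≤ n := hn
    have hc : ((r + (n - 1) : ℕ) : ℤ) = (r : ℤ) + (n : ℤ) - 1 := by
      rw [Nat.cast_add, Nat.cast_sub hn1, Nat.cast_one]; ring
    rw [hc]
    constructor <;> omega
  · have ex : (((v : ℕ) : ℤ) : ZMod (P.sitesPerDir 0 μ)) = x μ := by
      rw [hv, Int.cast_natCast, ZMod.natCast_zmod_val]
    have ex' : (((v' : ℕ) : ℤ) : ZMod (P.sitesPerDir 0 μ)) = x' μ := by
      rw [hv', Int.cast_natCast, ZMod.natCast_zmod_val]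
    have : ((ctr K K₀ j μ + (z + ((v' : ℤ) - (v : ℤ))) : ℤ) : ZMod (P.sitesPerDir 0 μ))
        = ((ctr K K₀ j μ + z : ℤ) : ZMod (P.sitesPerDir 0 μ)) + (((v' : ℕ) : ℤ) : ZMod (P.sitesPerDir 0 μ))
          - (((v : ℕ) : ℤ) : ZMod (P.sitesPerDir 0 μ)) := by
      push_cast; ring
    rw [this, ← e, ex, ex']
    ring

end Geometry

/-! ## §3 Row multiplicity: at most `2^d` cubes have a given site within `r < M` of their centres -/

section Multiplicity

/-- Two DIFFERENT labels of one direction whose centres are both within `r < h` of the same torus label differ, after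
unwinding, by EXACTLY `h`: `|z − z′| = h`. [folklore] -/
private theorem abs_sub_eq_of_two_near {S h Nn : ℕ} (hS : S = Nn * h) (hh : 0 < h) {r : ℕ} (hr : r < h)
    {i i' : Fin Nn} {z z' : ℤ} (hz : |z| ≤ r) (hz' : |z'| ≤ r)
    (e : (((h : ℤ) * (i : ℕ) + z : ℤ) : ZMod S) = (((h : ℤ) * (i' : ℕ) + z' : ℤ) : ZMod S)) (hne : i ≠ i') :
    |z - z'| = h := by
  rw [ZMod.intCast_eq_intCast_iff_dvd_sub] at e
  obtain ⟨q, hq⟩ := e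
  rw [hS] at hq
  push_cast at hq
  -- `z' − z = h·k` with `k = qN − (i' − i)`
  set k : ℤ := q * Nn - ((i' : ℕ) - (i : ℕ) : ℤ) with hk
  have hzk : z' - z = (h : ℤ) * k := by rw [hk]; linarith
  have hhk : |z' - z| = (h : ℤ) * |k| := by
    rw [hzk, abs_mul, abs_of_nonneg (by positivity : (0 : ℤ) ≤ h)]
  have hlt : (h : ℤ) * |k| < (h : ℤ) * 2 := by
    rw [← hhk]
    have := abs_sub z' z
    have : |z' - z| ≤ |z'| + |z| := abs_sub _ _
    omega
  have hk2 : |k| < 2 := lt_of_mul_lt_mul_left hlt (by positivity)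
  have hk0 : k ≠ 0 := by
    intro h0
    -- then `qN = i' − i`, and `|i' − i| < N` forces `i = i'`
    have hdiv : (Nn : ℤ) ∣ ((i' : ℕ) - (i : ℕ) : ℤ) := ⟨q, by rw [hk] at h0; linarith⟩
    have hsmall : (((i' : ℕ) - (i : ℕ) : ℤ)).natAbs < (Nn : ℤ).natAbs := by
      have h1 := i.isLt; have h2 := i'.isLt
      omega
    have hzero := Int.eq_zero_of_dvd_of_natAbs_lt_natAbs hdiv hsmall
    exact hne (Fin.ext (by omega))
  have hk1 : |k| = 1 := by
    have := abs_nonneg k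
    have : |k| ≠ 0 := abs_ne_zero.mpr hk0
    omega
  rw [abs_sub_comm, hhk, hk1, mul_one]

/-- **At most two labels per direction**: for `r < h` at most two `i ∈ ℤ/Nℤ` have the torus label `v` within `r` of `h·i`
(three would need three integers pairwise at distance exactly `h`). [folklore] -/
private theorem card_near_dir_le_two {S h Nn : ℕ} (hS : S = Nn * h) (hh : 0 < h) {r : ℕ} (hr : r < h) (v : ZMod S) :
    (Finset.univ.filter fun i : Fin Nn =>
        ∃ z ∈ Finset.Icc (-(r : ℤ)) r, v = (((h : ℤ) * (i : ℕ) + z : ℤ) : ZMod S)).card ≤ 2 := by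
  by_contra hc
  rw [not_le, Finset.two_lt_card] at hc
  obtain ⟨a, ha, b, hb, c, hcm, hab, hac, hbc⟩ := hc
  simp only [Finset.mem_filter, Finset.mem_univ, true_and, Finset.mem_Icc] at ha hb hcm
  obtain ⟨za, hza, ea⟩ := ha
  obtain ⟨zb, hzb, eb⟩ := hb
  obtain ⟨zc, hzc, ec⟩ := hcm
  have hza' : |za| ≤ r := abs_le.mpr ⟨hza.1, hza.2⟩
  have hzb' : |zb| ≤ r := abs_le.mpr ⟨hzb.1, hzb.2⟩
  have hzc' : |zc| ≤ r := abs_le.mpr ⟨hzc.1, hzc.2⟩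
  have h1 := abs_sub_eq_of_two_near hS hh hr hza' hzb' (ea.symm.trans eb) hab
  have h2 := abs_sub_eq_of_two_near hS hh hr hza' hzc' (ea.symm.trans ec) hac
  have h3 := abs_sub_eq_of_two_near hS hh hr hzb' hzc' (eb.symm.trans ec) hbc
  have hh' : (0 : ℤ) < h := by exact_mod_cast hh
  rw [abs_eq hh'.le] at h1 h2 h3
  omega

variable {K K₀ : ℕ}

/-- **ROW MULTIPLICITY `2^d`**: for `r < M`, a site of the torus lies within `r` of the centres `Mj` of at most `2^d` cubes
(the number of cubes «□_j» that can see a point, p. 576: «at most 2^d»). [cite: Balaban1983RegularityDecay, §2 pp.575–576] -/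
theorem card_filter_near_le (hK : K ≤ P.K) (hK₀ : K₀ ∣ P.M) (hK₀' : 1 ≤ K₀) {r : ℕ} (hr : r < half P K K₀) (x : Site P 0) :
    (Finset.univ.filter fun j : Lab P K K₀ => Near K K₀ r j x).card ≤ 2 ^ P.d := by
  classical
  set T : (μ : Fin P.d) → Finset (Fin (nLab P K K₀ μ)) := fun μ =>
    Finset.univ.filter fun i : Fin (nLab P K K₀ μ) =>
      ∃ z ∈ Finset.Icc (-(r : ℤ)) r, x μ = (((half P K K₀ : ℤ) * (i : ℕ) + z : ℤ) : ZMod (P.sitesPerDir 0 μ)) with hT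
  have hsub : (Finset.univ.filter fun j : Lab P K K₀ => Near K K₀ r j x) ⊆ Fintype.piFinset T := by
    intro j hj
    rw [Finset.mem_filter] at hj
    rw [Fintype.mem_piFinset]
    intro μ
    rw [hT, Finset.mem_filter]
    exact ⟨Finset.mem_univ _, hj.2 μ⟩
  refine (Finset.card_le_card hsub).trans ?_
  rw [Fintype.card_piFinset]
  calc ∏ μ, (T μ).card ≤ ∏ _μ : Fin P.d, 2 :=
        Finset.prod_le_prod' fun μ _ =>
          card_near_dir_le_two (nLab_mul_half hK hK₀ μ).symm (half_pos hK₀') hr (x μ)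
    _ = 2 ^ P.d := by rw [Finset.prod_const, Finset.card_univ, Fintype.card_fin]

end Multiplicity

/-! ## §4 The periodic profiles: `h_j` with `Σ_j h_j² = 1` on the torus, and `θ_j` -/

section Profiles

/-- Periodisation of a profile over `ℝ/Nℤ`, three terms (enough when the profile vanishes off `]−1,1[` and `N ≥ 2`).
[cite: Balaban1983RegularityDecay, §2 p.575] -/
def per3 (g : ℝ → ℝ) (Nn : ℕ) (t : ℝ) : ℝ := g t + g (t - Nn) + g (t + Nn)

/-- Evaluation of the periodisation at `u + mN`, `|u| ≤ 1`, `|m| ≤ 1`, `N ≥ 2`: only the term `g(u)` survives.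
[cite: Balaban1983RegularityDecay, §2 p.575] -/
theorem per3_eval {g : ℝ → ℝ} (hg : ∀ t, 1 ≤ |t| → g t = 0) {Nn : ℕ} (hN : 2 ≤ Nn) {u : ℝ} (hu : |u| ≤ 1)
    {m : ℤ} (hm : |m| ≤ 1) : per3 g Nn (u + m * Nn) = g u := by
  have hN' : (2 : ℝ) ≤ Nn := by exact_mod_cast hN
  obtain ⟨hu1, hu2⟩ := abs_le.mp hu
  have hm' : m = -1 ∨ m = 0 ∨ m = 1 := by
    obtain ⟨h1, h2⟩ := abs_le.mp hm; omega
  unfold per3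
  rcases hm' with h | h | h <;> subst h <;> push_cast
  · rw [hg (u + -1 * Nn) (by rw [abs_of_nonpos (by linarith)]; linarith),
      hg (u + -1 * Nn - Nn) (by rw [abs_of_nonpos (by linarith)]; linarith),
      show u + -1 * (Nn : ℝ) + Nn = u by ring]
    ring
  · rw [hg (u + 0 * Nn - Nn) (by rw [abs_of_nonpos (by linarith)]; linarith),
      hg (u + 0 * Nn + Nn) (by rw [abs_of_nonneg (by linarith)]; linarith),
      show u + 0 * (Nn : ℝ) = u by ring]
    ring
  · rw [hg (u + 1 * Nn) (by rw [abs_of_nonneg (by linarith)]; linarith),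
      hg (u + 1 * Nn + Nn) (by rw [abs_of_nonneg (by linarith)]; linarith),
      show u + 1 * (Nn : ℝ) - Nn = u by ring]
    ring

/-- r01's `h` vanishes off `]−⅝, ⅝[`, in particular for `|t| ≥ 1`. [cite: Balaban1983RegularityDecay, §2 p.575] -/
theorem hprof_zero_of_one_le (t : ℝ) (ht : 1 ≤ |t|) : hprof t = 0 :=
  hprof_eq_zero (by linarith)

/-- r01's `θ` vanishes for `|t| ≥ 1`. [cite: Balaban1983RegularityDecay, §2 p.575] -/
theorem thetaProf_zero_of_one_le (t : ℝ) (ht : 1 ≤ |t|) : thetaProf t = 0 :=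
  thetaProf_eq_zero_one ht

variable (K K₀ : ℕ)

/-- **`h_j` ON THE TORUS**: `h_j(x) = Π_μ h_per(x_μ/M − j_μ)` with the `N_μ`-periodisation of r01's profile `h` — the
partition of unity «{h_j}» of p. 575 on `T_η` (there `T_η` has no boundary; every cube is interior).
[cite: Balaban1983RegularityDecay, §2 p.575] -/
def hTor (j : Lab P K K₀) (x : Site P 0) : ℝ :=
  ∏ μ, per3 hprof (nLab P K K₀ μ) (((x μ).val : ℝ) / half P K K₀ - ((j μ : ℕ) : ℝ))

/-- **`θ_j` ON THE TORUS**: `θ_j(x) = Π_μ θ_per(x_μ/M − j_μ)`. [cite: Balaban1983RegularityDecay, §2 p.575] -/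
def thetaTor (j : Lab P K K₀) (x : Site P 0) : ℝ :=
  ∏ μ, per3 thetaProf (nLab P K K₀ μ) (((x μ).val : ℝ) / half P K K₀ - ((j μ : ℕ) : ℝ))

variable {K K₀}

/-- The three-term periodisation of `h` is one of its terms (the other two vanish): for `N ≥ 2` there is `m ∈ {−1,0,1}`
with `h_per(t) = h(t − mN)`. [cite: Balaban1983RegularityDecay, §2 p.575] -/
theorem per3_hprof_eq_single {Nn : ℕ} (hN : 2 ≤ Nn) (t : ℝ) :
    ∃ m : ℤ, |m| ≤ 1 ∧ per3 hprof Nn t = hprof (t - m * Nn) := by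
  have hN' : (2 : ℝ) ≤ Nn := by exact_mod_cast hN
  by_cases h0 : hprof t = 0
  · by_cases h1 : hprof (t - Nn) = 0
    · refine ⟨-1, by norm_num, ?_⟩
      simp only [per3, h0, h1, zero_add]
      push_cast; ring_nf
    · -- `|t − N| < ⅝` forces `h(t + N) = 0`
      have ht : |t - Nn| < 5 / 8 := by
        by_contra hc; exact h1 (hprof_eq_zero (not_lt.mp hc))
      refine ⟨1, by norm_num, ?_⟩
      have h2 : hprof (t + Nn) = 0 := by
        apply hprof_eq_zero
        have := (abs_lt.mp ht).1
        rw [abs_of_nonneg (by linarith)]; linarith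
      simp only [per3, h0, h2, zero_add, add_zero]
      push_cast; ring_nf
  · have ht : |t| < 5 / 8 := by
      by_contra hc; exact h0 (hprof_eq_zero (not_lt.mp hc))
    obtain ⟨ht1, ht2⟩ := abs_lt.mp ht
    refine ⟨0, by norm_num, ?_⟩
    have h1 : hprof (t - Nn) = 0 := hprof_eq_zero (by rw [abs_of_nonpos (by linarith)]; linarith)
    have h2 : hprof (t + Nn) = 0 := hprof_eq_zero (by rw [abs_of_nonneg (by linarith)]; linarith)
    simp only [per3, h1, h2, add_zero]
    push_cast; ring_nf

/-- `0 ≤ h_per ≤ 1`. [cite: Balaban1983RegularityDecay, §2 p.575] -/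
theorem per3_hprof_mem_Icc {Nn : ℕ} (hN : 2 ≤ Nn) (t : ℝ) : per3 hprof Nn t ∈ Set.Icc (0 : ℝ) 1 := by
  obtain ⟨m, -, hm⟩ := per3_hprof_eq_single hN t
  rw [hm]
  exact ⟨hprof_nonneg _, hprof_le_one _⟩

/-- `0 ≤ h_j`. [cite: Balaban1983RegularityDecay, §2 p.575] -/
theorem hTor_nonneg (hK : K ≤ P.K) (hK₀ : K₀ ∣ P.M) (hK₀' : 1 ≤ K₀) (j : Lab P K K₀) (x : Site P 0) :
    0 ≤ hTor K K₀ j x :=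
  Finset.prod_nonneg fun μ _ => (per3_hprof_mem_Icc (two_le_nLab hK hK₀ hK₀' μ) _).1

/-- `h_j ≤ 1`. [cite: Balaban1983RegularityDecay, §2 p.575] -/
theorem hTor_le_one (hK : K ≤ P.K) (hK₀ : K₀ ∣ P.M) (hK₀' : 1 ≤ K₀) (j : Lab P K K₀) (x : Site P 0) :
    hTor K K₀ j x ≤ 1 :=
  Finset.prod_le_one (fun μ _ => (per3_hprof_mem_Icc (two_le_nLab hK hK₀ hK₀' μ) _).1)
    fun μ _ => (per3_hprof_mem_Icc (two_le_nLab hK hK₀ hK₀' μ) _).2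

/-- `|h_j| ≤ 1`. [cite: Balaban1983RegularityDecay, §2 p.575] -/
theorem abs_hTor_le_one (hK : K ≤ P.K) (hK₀ : K₀ ∣ P.M) (hK₀' : 1 ≤ K₀) (j : Lab P K K₀) (x : Site P 0) :
    |hTor K K₀ j x| ≤ 1 := by
  rw [abs_of_nonneg (hTor_nonneg hK hK₀ hK₀' j x)]
  exact hTor_le_one hK hK₀ hK₀' j x

/-- Products of far-apart translates of `h` vanish: `h(a)h(b) = 0` if `|a − b| ≥ 5/4`. [cite: Balaban1983RegularityDecay, §2 p.575] -/
theorem hprof_mul_hprof_eq_zero {a b : ℝ} (h : 5 / 4 ≤ |a - b|) : hprof a * hprof b = 0 := by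
  by_cases ha : 5 / 8 ≤ |a|
  · rw [hprof_eq_zero ha, zero_mul]
  · have hb : 5 / 8 ≤ |b| := by
      by_contra hb
      have h1 := abs_sub_abs_le_abs_sub a b
      have h2 := abs_sub_abs_le_abs_sub b a
      rw [abs_sub_comm b a] at h2
      push Not at ha hb
      have : |a - b| < 5 / 4 := by
        have := abs_abs_sub_abs_le_abs_sub a b  -- ||a| - |b|| ≤ |a - b|; not enough, use triangle
        calc |a - b| ≤ |a| + |b| := abs_sub a b
          _ < 5 / 8 + 5 / 8 := add_lt_add ha hb
          _ = 5 / 4 := by norm_num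
      linarith
    rw [hprof_eq_zero hb, mul_zero]

/-- **THE ONE-DIMENSIONAL PERIODIC SQUARE SUM**: for `N ≥ 2` and `0 ≤ t < N`, `Σ_{i ∈ ℤ/Nℤ} h_per(t − i)² = 1` — the torus
form of «Σ_{j∈Z} h_j² = 1» (r01's `sum_hprof_sq` over the window `[−N, 2N)` of integers, regrouped mod `N`).
[cite: Balaban1983RegularityDecay, §2 p.575] -/
theorem sum_per3_hprof_sq {Nn : ℕ} (hN : 2 ≤ Nn) {t : ℝ} (ht0 : 0 ≤ t) (htN : t < Nn) :
    ∑ i : Fin Nn, per3 hprof Nn (t - ((i : ℕ) : ℝ)) ^ 2 = 1 := by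
  classical
  have hN' : (2 : ℝ) ≤ Nn := by exact_mod_cast hN
  -- the squares: cross terms vanish
  have hsq : ∀ i : Fin Nn, per3 hprof Nn (t - ((i : ℕ) : ℝ)) ^ 2
      = hprof (t - ((i : ℕ) : ℤ)) ^ 2 + hprof (t - (((i : ℕ) : ℤ) + Nn : ℤ)) ^ 2
        + hprof (t - (((i : ℕ) : ℤ) - Nn : ℤ)) ^ 2 := by
    intro i
    have e1 : (t - ((i : ℕ) : ℝ) - Nn) = t - ((((i : ℕ) : ℤ) + Nn : ℤ) : ℝ) := by push_cast; ring
    have e2 : (t - ((i : ℕ) : ℝ) + Nn) = t - ((((i : ℕ) : ℤ) - Nn : ℤ) : ℝ) := by push_cast; ring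
    have e0 : (t - ((i : ℕ) : ℝ)) = t - ((((i : ℕ) : ℤ) : ℤ) : ℝ) := by push_cast; ring
    unfold per3
    rw [e1, e2, e0]
    set a := hprof (t - ((((i : ℕ) : ℤ) : ℤ) : ℝ))
    set b := hprof (t - ((((i : ℕ) : ℤ) + Nn : ℤ) : ℝ))
    set c := hprof (t - ((((i : ℕ) : ℤ) - Nn : ℤ) : ℝ))
    have hab : a * b = 0 := hprof_mul_hprof_eq_zero (by push_cast; rw [show t - (i : ℕ) - (t - ((i : ℕ) + Nn)) = (Nn : ℝ) by ring, abs_of_nonneg (by linarith)]; linarith)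
    have hac : a * c = 0 := hprof_mul_hprof_eq_zero (by push_cast; rw [show t - (i : ℕ) - (t - ((i : ℕ) - Nn)) = -(Nn : ℝ) by ring, abs_neg, abs_of_nonneg (by linarith)]; linarith)
    have hbc : b * c = 0 := hprof_mul_hprof_eq_zero (by push_cast; rw [show t - ((i : ℕ) + Nn) - (t - ((i : ℕ) - Nn)) = -(2 * (Nn : ℝ)) by ring, abs_neg, abs_of_nonneg (by linarith)]; linarith)
    nlinarith [hab, hac, hbc]
  simp_rw [hsq]
  -- regroup as a sum over the window of integers `{i, i + N, i − N : i < N}`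
  set g : ℤ → ℝ := fun n => hprof (t - n) ^ 2 with hg
  set tri : Fin Nn → Finset ℤ := fun i => {((i : ℕ) : ℤ), ((i : ℕ) : ℤ) + Nn, ((i : ℕ) : ℤ) - Nn} with htri
  have hdisj : Set.PairwiseDisjoint (↑(Finset.univ : Finset (Fin Nn))) tri := by
    intro i _ i' _ hii'
    rw [Function.onFun, Finset.disjoint_left]
    intro n hn hn'
    simp only [htri, Finset.mem_insert, Finset.mem_singleton] at hn hn'
    have h1 := i.isLt; have h2 := i'.isLt
    apply hii'
    apply Fin.ext
    rcases hn with rfl | rfl | rfl <;> rcases hn' with h | h | h <;> omega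
  have htri_sum : ∀ i : Fin Nn, ∑ n ∈ tri i, g n
      = g ((i : ℕ) : ℤ) + g (((i : ℕ) : ℤ) + Nn) + g (((i : ℕ) : ℤ) - Nn) := by
    intro i
    have hi := i.isLt
    rw [htri, Finset.sum_insert, Finset.sum_insert, Finset.sum_singleton]
    · ring
    · simp only [Finset.mem_singleton]; omega
    · simp only [Finset.mem_insert, Finset.mem_singleton]; omega
  have hre : ∑ i : Fin Nn, (g ((i : ℕ) : ℤ) + g (((i : ℕ) : ℤ) + Nn) + g (((i : ℕ) : ℤ) - Nn))
      = ∑ n ∈ (Finset.univ : Finset (Fin Nn)).biUnion tri, g n := by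
    rw [Finset.sum_biUnion hdisj]
    exact Finset.sum_congr rfl fun i _ => (htri_sum i).symm
  rw [show (∑ i : Fin Nn, (hprof (t - ((i : ℕ) : ℤ)) ^ 2 + hprof (t - (((i : ℕ) : ℤ) + Nn : ℤ)) ^ 2
      + hprof (t - (((i : ℕ) : ℤ) - Nn : ℤ)) ^ 2))
      = ∑ i : Fin Nn, (g ((i : ℕ) : ℤ) + g (((i : ℕ) : ℤ) + Nn) + g (((i : ℕ) : ℤ) - Nn)) from rfl, hre]
  apply sum_hprof_sq
  intro n hn
  have hmem := mem_pair_of_hprof_ne_zero hn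
  rw [Finset.mem_insert, Finset.mem_singleton] at hmem
  have hfl0 : 0 ≤ ⌊t⌋ := Int.floor_nonneg.mpr ht0
  have hflN : ⌊t⌋ < Nn := Int.floor_lt.mpr (by exact_mod_cast htN)
  rw [Finset.mem_biUnion]
  have hn0 : 0 ≤ n := by omega
  have hnN : n ≤ Nn := by omega
  by_cases hlt : n < Nn
  · refine ⟨⟨n.toNat, by omega⟩, Finset.mem_univ _, ?_⟩
    simp only [htri, Finset.mem_insert, Finset.mem_singleton, Int.toNat_of_nonneg hn0, true_or]
  · have hn' : n = Nn := le_antisymm hnN (not_lt.mp hlt)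
    refine ⟨⟨0, by omega⟩, Finset.mem_univ _, ?_⟩
    simp only [htri, Finset.mem_insert, Finset.mem_singleton]
    right; left; push_cast; omega

/-! ### The torus label of a chart point, pull-backs of `h_j`, `θ_j` along the chart -/

/-- The `val` (representative in `[0, S)`) of an integer label `w ∈ [−S, S)` of a torus direction `ℤ/Sℤ` of (1.2) is `w` or
`w + S`. [cite: Balaban1982Higgs1, (1.2) p.604] -/
theorem val_intCast_eq {S : ℕ} [NeZero S] {w : ℤ} (h0 : -(S : ℤ) ≤ w) (h1 : w < S) :
    ∃ m : ℤ, (m = 0 ∨ m = 1) ∧ (((w : ZMod S).val : ℕ) : ℤ) = w + m * S := by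
  by_cases hw : 0 ≤ w
  · exact ⟨0, Or.inl rfl, by rw [ZMod.val_intCast, Int.emod_eq_of_lt hw h1]; ring⟩
  · refine ⟨1, Or.inr rfl, ?_⟩
    have e : ((w : ℤ) : ZMod S) = ((w + S : ℤ) : ZMod S) := by
      push_cast; rw [ZMod.natCast_self, add_zero]
    rw [e, ZMod.val_intCast, Int.emod_eq_of_lt (by omega) (by omega)]; ring

/-- The centre label is at most `S − M`: `Mj_μ ≤ M(N_μ − 1)`. [cite: Balaban1983RegularityDecay, §2 p.575] -/
theorem ctr_le (hK : K ≤ P.K) (hK₀ : K₀ ∣ P.M) (j : Lab P K K₀) (μ : Fin P.d) :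
    ctr K K₀ j μ + half P K K₀ ≤ P.sitesPerDir 0 μ := by
  unfold ctr
  have hj : (j μ : ℕ) + 1 ≤ nLab P K K₀ μ := (j μ).isLt
  have e := nLab_mul_half hK hK₀ μ
  have : (half P K K₀ : ℤ) * ((j μ : ℕ) : ℤ) + half P K K₀ = (half P K K₀ : ℤ) * (((j μ : ℕ) + 1 : ℕ) : ℤ) := by
    push_cast; ring
  rw [this, ← e]
  push_cast
  rw [mul_comm]
  exact mul_le_mul_of_nonneg_right (by exact_mod_cast hj) (by positivity)

/-- `0 ≤ Mj_μ`. [cite: Balaban1983RegularityDecay, §2 p.575] -/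
theorem ctr_nonneg (j : Lab P K K₀) (μ : Fin P.d) : 0 ≤ ctr K K₀ j μ := by
  unfold ctr; positivity

/-- **The chart argument**: for box coordinates `y ∈ [0, 2M)^d`, the reduced coordinate of the chart point relative to the
centre is `x_μ/M − j_μ = (y_μ/M − 1) + mN_μ` with `m ∈ {0, 1}` (no wrap-around inside a cube).
[cite: Balaban1983RegularityDecay, §2 p.575] -/
theorem chart_arg (hK : K ≤ P.K) (hK₀ : K₀ ∣ P.M) (hK₀' : 1 ≤ K₀) (j : Lab P K K₀) {y : Fin P.d → ℤ}
    (hy : ∀ μ, 0 ≤ y μ ∧ y μ < 2 * half P K K₀) (μ : Fin P.d) :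
    ∃ m : ℤ, |m| ≤ 1 ∧
      ((((chart K K₀ j y) μ).val : ℕ) : ℝ) / half P K K₀ - ((j μ : ℕ) : ℝ)
        = ((y μ : ℝ) / half P K K₀ - 1) + m * (nLab P K K₀ μ : ℝ) := by
  have hh : 0 < half P K K₀ := half_pos hK₀'
  have hhR : (0 : ℝ) < half P K K₀ := by exact_mod_cast hh
  have hc := ctr_le hK hK₀ j μ
  have hc0 := ctr_nonneg (K := K) (K₀ := K₀) j μ
  have hS := nLab_mul_half hK hK₀ μ
  set w : ℤ := ctr K K₀ j μ - half P K K₀ + y μ with hw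
  have hw0 : -(P.sitesPerDir 0 μ : ℤ) ≤ w := by
    have := (hy μ).1
    have : (half P K K₀ : ℤ) ≤ P.sitesPerDir 0 μ := by
      have := Nat.le_of_dvd (P.sitesPerDir_pos 0 μ) (half_dvd hK hK₀ μ); exact_mod_cast this
    omega
  have hw1 : w < P.sitesPerDir 0 μ := by have := (hy μ).2; omega
  obtain ⟨m, hm, hval⟩ := val_intCast_eq (S := P.sitesPerDir 0 μ) hw0 hw1
  refine ⟨m, by rcases hm with rfl | rfl <;> norm_num, ?_⟩
  have hvalR : ((((chart K K₀ j y) μ).val : ℕ) : ℝ) = (w : ℝ) + m * (P.sitesPerDir 0 μ : ℝ) := by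
    have : ((((w : ZMod (P.sitesPerDir 0 μ)).val : ℕ) : ℤ) : ℝ) = ((w + m * (P.sitesPerDir 0 μ : ℕ) : ℤ) : ℝ) := by
      rw [hval]
    push_cast at this
    rw [← this]
    rfl
  rw [hvalR, hw, ← hS]
  unfold ctr
  push_cast
  field_simp
  ring

/-- **PULL-BACK OF `h_j` ALONG THE CHART = r01's PROFILE**: `h_j(Mj − M + y) = Π_μ h(y_μ/M − 1)` for `y ∈ [0, 2M)^d` — i.e.
on the cube, in box coordinates, the torus bump IS the print's `h_j` centred at the box point `M·(1,…,1)` (the lineage's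
`B4Eq220PartitionSizes.hZ … 1`). [cite: Balaban1983RegularityDecay, §2 p.575] -/
theorem hTor_chart (hK : K ≤ P.K) (hK₀ : K₀ ∣ P.M) (hK₀' : 1 ≤ K₀) (j : Lab P K K₀) {y : Fin P.d → ℤ}
    (hy : ∀ μ, 0 ≤ y μ ∧ y μ < 2 * half P K K₀) :
    hTor K K₀ j (chart K K₀ j y) = ∏ μ, hprof ((y μ : ℝ) / half P K K₀ - 1) := by
  unfold hTor
  refine Finset.prod_congr rfl fun μ _ => ?_
  obtain ⟨m, hm, e⟩ := chart_arg hK hK₀ hK₀' j hy μ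
  rw [e]
  have hhR : (0 : ℝ) < half P K K₀ := by exact_mod_cast half_pos (P := P) (K := K) hK₀'
  refine per3_eval hprof_zero_of_one_le (two_le_nLab hK hK₀ hK₀' μ) ?_ hm
  rw [abs_le]
  have h0 : (0 : ℝ) ≤ y μ := by exact_mod_cast (hy μ).1
  have h1 : (y μ : ℝ) < 2 * half P K K₀ := by exact_mod_cast (hy μ).2
  constructor
  · rw [le_sub_iff_add_le, neg_add_cancel]; positivity
  · rw [sub_le_iff_le_add, div_le_iff₀ hhR]; linarith

/-- **PULL-BACK OF `θ_j` ALONG THE CHART**: `θ_j(Mj − M + y) = Π_μ θ(y_μ/M − 1)` for `y ∈ [0, 2M)^d` (the lineage's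
`B4CubeFields22.thetaZ … 1`). [cite: Balaban1983RegularityDecay, §2 p.575] -/
theorem thetaTor_chart (hK : K ≤ P.K) (hK₀ : K₀ ∣ P.M) (hK₀' : 1 ≤ K₀) (j : Lab P K K₀) {y : Fin P.d → ℤ}
    (hy : ∀ μ, 0 ≤ y μ ∧ y μ < 2 * half P K K₀) :
    thetaTor K K₀ j (chart K K₀ j y) = ∏ μ, thetaProf ((y μ : ℝ) / half P K K₀ - 1) := by
  unfold thetaTor
  refine Finset.prod_congr rfl fun μ _ => ?_
  obtain ⟨m, hm, e⟩ := chart_arg hK hK₀ hK₀' j hy μ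
  rw [e]
  have hhR : (0 : ℝ) < half P K K₀ := by exact_mod_cast half_pos (P := P) (K := K) hK₀'
  refine per3_eval thetaProf_zero_of_one_le (two_le_nLab hK hK₀ hK₀' μ) ?_ hm
  rw [abs_le]
  have h0 : (0 : ℝ) ≤ y μ := by exact_mod_cast (hy μ).1
  have h1 : (y μ : ℝ) < 2 * half P K K₀ := by exact_mod_cast (hy μ).2
  constructor
  · rw [le_sub_iff_add_le, neg_add_cancel]; positivity
  · rw [sub_le_iff_le_add, div_le_iff₀ hhR]; linarith

/-- Chart points whose box coordinates are within `r` of the box centre `M·(1,…,1)` are within `r` of `Mj`.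
[cite: Balaban1983RegularityDecay, §2 p.575] -/
theorem near_chart {r : ℕ} (j : Lab P K K₀) {y : Fin P.d → ℤ} (hy : ∀ μ, |y μ - half P K K₀| ≤ r) :
    Near K K₀ r j (chart K K₀ j y) := by
  intro μ
  refine ⟨y μ - half P K K₀, ?_, ?_⟩
  · rw [Finset.mem_Icc]; exact abs_le.mp (hy μ)
  · show (((ctr K K₀ j μ - half P K K₀ + y μ : ℤ)) : ZMod (P.sitesPerDir 0 μ)) = _
    congr 1; ring

/-- The cube window in chart form: `□_j = chart_j([0, 2M)^d)`. [cite: Balaban1983RegularityDecay, §2 p.575] -/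
theorem inCube_iff_exists_chart (j : Lab P K K₀) (x : Site P 0) :
    InCube K K₀ j x ↔ ∃ y : Fin P.d → ℤ, (∀ μ, 0 ≤ y μ ∧ y μ < 2 * half P K K₀) ∧ x = chart K K₀ j y := by
  constructor
  · intro hx
    choose z hz using hx
    refine ⟨fun μ => z μ + half P K K₀, fun μ => ?_, ?_⟩
    · have := (hz μ).1; rw [Finset.mem_Ico] at this
      show 0 ≤ z μ + half P K K₀ ∧ z μ + half P K K₀ < 2 * half P K K₀
      constructor <;> omega
    · funext μ
      rw [(hz μ).2]
      show _ = (((ctr K K₀ j μ - half P K K₀ + (z μ + half P K K₀) : ℤ)) : ZMod (P.sitesPerDir 0 μ))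
      congr 1; ring
  · rintro ⟨y, hy, rfl⟩ μ
    refine ⟨y μ - half P K K₀, ?_, ?_⟩
    · rw [Finset.mem_Ico]; have := hy μ; constructor <;> omega
    · show (((ctr K K₀ j μ - half P K K₀ + y μ : ℤ)) : ZMod (P.sitesPerDir 0 μ)) = _
      congr 1; ring

/-- The chart is injective on the box `[0, 2M)^d` (the cube does not wrap: `2M ≤ N_μM = |T_ε|_μ`).
[cite: Balaban1983RegularityDecay, §2 p.575] -/
theorem chart_injOn (hK : K ≤ P.K) (hK₀ : K₀ ∣ P.M) (hK₀' : 1 ≤ K₀) (j : Lab P K K₀) {y y' : Fin P.d → ℤ}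
    (hy : ∀ μ, 0 ≤ y μ ∧ y μ < 2 * half P K K₀) (hy' : ∀ μ, 0 ≤ y' μ ∧ y' μ < 2 * half P K K₀)
    (h : chart K K₀ j y = chart K K₀ j y') : y = y' := by
  funext μ
  have e := congrFun h μ
  change (((ctr K K₀ j μ - half P K K₀ + y μ : ℤ)) : ZMod (P.sitesPerDir 0 μ))
    = (((ctr K K₀ j μ - half P K K₀ + y' μ : ℤ)) : ZMod (P.sitesPerDir 0 μ)) at e
  rw [ZMod.intCast_eq_intCast_iff_dvd_sub] at e
  have hS : 2 * (half P K K₀ : ℤ) ≤ P.sitesPerDir 0 μ := by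
    have := nLab_mul_half hK hK₀ μ
    have h2 := two_le_nLab hK hK₀ hK₀' μ
    have : 2 * half P K K₀ ≤ P.sitesPerDir 0 μ := by
      rw [← this]; exact Nat.mul_le_mul_right _ h2
    exact_mod_cast this
  have hsmall : ((ctr K K₀ j μ - half P K K₀ + y' μ) - (ctr K K₀ j μ - half P K K₀ + y μ)).natAbs
      < ((P.sitesPerDir 0 μ : ℕ) : ℤ).natAbs := by
    have h1 := hy μ; have h2 := hy' μ
    omega
  have := Int.eq_zero_of_dvd_of_natAbs_lt_natAbs e hsmall
  omega

/-- **SUPPORT OF `h_j`**: `h_j(x) ≠ 0 ⇒ |x − Mj| ≤ ⅝M` coordinatewise on the torus (the print's `supp h ⊂ ]−⅔, ⅔[`, here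
r01's `tsupport h ⊆ [−⅝, ⅝]`; integer radius `⌊5M/8⌋`). [cite: Balaban1983RegularityDecay, §2 p.575] -/
theorem near_of_hTor_ne_zero (hK : K ≤ P.K) (hK₀ : K₀ ∣ P.M) (hK₀' : 1 ≤ K₀) {j : Lab P K K₀} {x : Site P 0}
    (hx : hTor K K₀ j x ≠ 0) : Near K K₀ (5 * half P K K₀ / 8) j x := by
  intro μ
  have hh : 0 < half P K K₀ := half_pos hK₀'
  have hhR : (0 : ℝ) < half P K K₀ := by exact_mod_cast hh
  have hS := nLab_mul_half hK hK₀ μ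
  have hfac : per3 hprof (nLab P K K₀ μ) ((((x μ).val : ℕ) : ℝ) / half P K K₀ - ((j μ : ℕ) : ℝ)) ≠ 0 := by
    intro h0
    exact hx (Finset.prod_eq_zero (Finset.mem_univ μ) h0)
  obtain ⟨m, hm, hper⟩ := per3_hprof_eq_single (two_le_nLab hK hK₀ hK₀' μ)
    ((((x μ).val : ℕ) : ℝ) / half P K K₀ - ((j μ : ℕ) : ℝ))
  rw [hper] at hfac
  have hlt : |(((x μ).val : ℕ) : ℝ) / half P K K₀ - ((j μ : ℕ) : ℝ) - m * (nLab P K K₀ μ : ℝ)| < 5 / 8 := by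
    by_contra hc; exact hfac (hprof_eq_zero (not_lt.mp hc))
  -- the integer displacement
  set z : ℤ := ((x μ).val : ℤ) - ctr K K₀ j μ - m * (P.sitesPerDir 0 μ : ℤ) with hz
  have hSR : ((nLab P K K₀ μ : ℕ) : ℝ) * (half P K K₀ : ℝ) = (P.sitesPerDir 0 μ : ℝ) := by exact_mod_cast hS
  have hzR : (z : ℝ) / half P K K₀
      = (((x μ).val : ℕ) : ℝ) / half P K K₀ - ((j μ : ℕ) : ℝ) - m * (nLab P K K₀ μ : ℝ) := by
    rw [hz]; unfold ctr; push_cast; rw [← hSR]; field_simp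
  have habs : |(z : ℝ)| < 5 / 8 * half P K K₀ := by
    rw [← hzR, abs_div, abs_of_pos hhR, div_lt_iff₀ hhR] at hlt; exact hlt
  have h8 : 8 * |z| < 5 * (half P K K₀ : ℤ) := by
    have h1 : ((|z| : ℤ) : ℝ) = |(z : ℝ)| := Int.cast_abs
    have : (8 : ℝ) * ((|z| : ℤ) : ℝ) < 5 * ((half P K K₀ : ℕ) : ℝ) := by rw [h1]; linarith
    exact_mod_cast this
  refine ⟨z, ?_, ?_⟩
  · rw [Finset.mem_Icc, ← abs_le]
    have hdm := Nat.div_add_mod (5 * half P K K₀) 8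
    have hml := Nat.mod_lt (5 * half P K K₀) (show 0 < 8 by norm_num)
    set r : ℕ := 5 * half P K K₀ / 8 with hr
    zify at hdm hml
    omega
  · have ex : (((x μ).val : ℕ) : ZMod (P.sitesPerDir 0 μ)) = x μ := ZMod.natCast_zmod_val _
    have : ((ctr K K₀ j μ + z : ℤ) : ZMod (P.sitesPerDir 0 μ))
        = (((x μ).val : ℕ) : ℤ) - (m : ZMod (P.sitesPerDir 0 μ)) * ((P.sitesPerDir 0 μ : ℕ) : ZMod (P.sitesPerDir 0 μ)) := by
      rw [hz]; push_cast; ring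
    rw [this, ZMod.natCast_self, mul_zero, sub_zero, Int.cast_natCast, ex]

/-- **`θ_j = 1` ON THE `¾M`-CORE**: if `|x − Mj| ≤ r` with `4r ≤ 3M` then `θ_j(x) = 1` (r01's `θ = 1` on `[−¾, ¾]`).
[cite: Balaban1983RegularityDecay, §2 p.575] -/
theorem thetaTor_eq_one_of_near (hK : K ≤ P.K) (hK₀ : K₀ ∣ P.M) (hK₀' : 1 ≤ K₀) {r : ℕ} (hr : 4 * r ≤ 3 * half P K K₀)
    {j : Lab P K K₀} {x : Site P 0} (hx : Near K K₀ r j x) : thetaTor K K₀ j x = 1 := by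
  unfold thetaTor
  refine Finset.prod_eq_one fun μ _ => ?_
  have hh : 0 < half P K K₀ := half_pos hK₀'
  have hhR : (0 : ℝ) < half P K K₀ := by exact_mod_cast hh
  have hS := nLab_mul_half hK hK₀ μ
  obtain ⟨z, hz, e⟩ := hx μ
  rw [Finset.mem_Icc] at hz
  have hc := ctr_le hK hK₀ j μ
  have hc0 := ctr_nonneg (K := K) (K₀ := K₀) j μ
  have hw0 : -(P.sitesPerDir 0 μ : ℤ) ≤ ctr K K₀ j μ + z := by omega
  have hw1 : ctr K K₀ j μ + z < P.sitesPerDir 0 μ := by omega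
  obtain ⟨m, hm, hval⟩ := val_intCast_eq (S := P.sitesPerDir 0 μ) hw0 hw1
  have hvalR : ((((x μ).val : ℕ)) : ℝ) = ((ctr K K₀ j μ + z : ℤ) : ℝ) + m * (P.sitesPerDir 0 μ : ℝ) := by
    have h1 : ((((x μ).val : ℕ)) : ℤ) = ctr K K₀ j μ + z + m * (P.sitesPerDir 0 μ : ℕ) := by rw [e]; exact hval
    have h2 : ((((x μ).val : ℕ)) : ℝ) = (((((x μ).val : ℕ)) : ℤ) : ℝ) := by push_cast; rfl
    rw [h2, h1]; push_cast; ring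
  have harg : ((((x μ).val : ℕ)) : ℝ) / half P K K₀ - ((j μ : ℕ) : ℝ)
      = (z : ℝ) / half P K K₀ + m * (nLab P K K₀ μ : ℝ) := by
    rw [hvalR, ← hS]; unfold ctr; push_cast; field_simp; ring
  rw [harg, per3_eval thetaProf_zero_of_one_le (two_le_nLab hK hK₀ hK₀' μ) _ (by rcases hm with rfl | rfl <;> norm_num)]
  · apply thetaProf_eq_one
    rw [abs_div, abs_of_pos hhR, div_le_iff₀ hhR]
    have : ((|z| : ℤ) : ℝ) ≤ r := by exact_mod_cast abs_le.mpr ⟨hz.1, hz.2⟩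
    have hr' : (4 : ℝ) * r ≤ 3 * half P K K₀ := by exact_mod_cast hr
    have : |(z : ℝ)| = ((|z| : ℤ) : ℝ) := by push_cast; rfl
    rw [this]; linarith
  · rw [abs_div, abs_of_pos hhR, div_le_iff₀ hhR]
    have : ((|z| : ℤ) : ℝ) ≤ r := by exact_mod_cast abs_le.mpr ⟨hz.1, hz.2⟩
    have hr' : (4 : ℝ) * r ≤ 3 * half P K K₀ := by exact_mod_cast hr
    have h' : |(z : ℝ)| = ((|z| : ℤ) : ℝ) := by push_cast; rfl
    rw [h']; linarith

/-- **«Σ_j h_j² = 1» ON THE TORUS, EXACTLY**: `Σ_{j ∈ Π_μ ℤ/N_μℤ} h_j(x)² = Π_μ (Σ_{i} h_per(x_μ/M − i)²) = 1` at every site.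
[cite: Balaban1983RegularityDecay, §2 p.575] -/
theorem sum_hTor_sq (hK : K ≤ P.K) (hK₀ : K₀ ∣ P.M) (hK₀' : 1 ≤ K₀) (x : Site P 0) :
    ∑ j : Lab P K K₀, hTor K K₀ j x ^ 2 = 1 := by
  classical
  unfold hTor
  simp_rw [← Finset.prod_pow]
  rw [← Fintype.prod_sum fun μ (i : Fin (nLab P K K₀ μ)) =>
    per3 hprof (nLab P K K₀ μ) ((((x μ).val : ℕ) : ℝ) / half P K K₀ - ((i : ℕ) : ℝ)) ^ 2]
  refine Finset.prod_eq_one fun μ _ => ?_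
  have hh : 0 < half P K K₀ := half_pos hK₀'
  have hhR : (0 : ℝ) < half P K K₀ := by exact_mod_cast hh
  refine sum_per3_hprof_sq (two_le_nLab hK hK₀ hK₀' μ) (by positivity) ?_
  rw [div_lt_iff₀ hhR]
  have h1 := ZMod.val_lt (x μ)
  have h2 := nLab_mul_half hK hK₀ μ
  have : (x μ).val < nLab P K K₀ μ * half P K K₀ := by omega
  exact_mod_cast this


end Profiles

end Literature.MathematicalPhysics.QuantumFieldTheory.Balaban1983to89.B1TorusCubeCover

end
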